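import Mathlib
import HarnessLib
import Summits.HubbardSuperconductivity.HubbardSuperconductivity.Theorems.KLProgrammeKLRegimeEngineIsoMomWitnessFlowDeep

/-!
# Route `KLProgramme` — crux K3 ENGINE (stmt-HubbardSuperconductivity-20437 `KLRegimeEngineV17F2`), row (b) `stub_engine_step_norms` (e78dfb33d2f7), producer
# hypothesis `hexI`: the DIRECT plain → iso weighted per-tuple transfer and the `hexI` witness from the E1 plain-line family + ONE geometric datum
# (the weighted iso SINGLE character sums) — no thin detour, no scale-0 datum, osc-free (cell gate-hubbard-kl, seat p3 g24, ITEM 7)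

WHY.  `isoMomFlowAt_of_wplainLine_flow_deep` (p729049) reads `hexI` from `hplainE1` + TWO geometric data (`hiso` = weighted iso × THIN pair sums, `hthin0` = the scale-0
thin weighted single, needed because the thin detour at `n = 1` reads the index-0 family).  The thin detour is unnecessary: the tree-weight plateau-pair lemma
`hubbardSectorPrescribedSumWt_refine_le_split_of_plateau_pair_treeWt` applies to the pair (trivial, trivial ; iso m) EXACTLY as k3c2-p3's (T3w)
`wprescribedSum_klAniso_le_of_plain_treeWt` applies it to (trivial, trivial ; thin J) — the trivial family sums to `1` everywhere, one parent per spin/charge — with the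
pair-weighted transfer sums of `E(klIsoFamily m)·S(1)` from the weighted iso SINGLE character sums (`overlapKernelWt_sums_le_of_charSumWt_le`, iso × trivial = iso).  So:
* §1 `transferSumsWt_klIso_single_le`, **`wprescribedSum_klIso_le_of_plain_treeWt`** (the iso twins, ANY tree weight, any Grassmann `G`, degree, leg);
* §2 **`isoFirstMomentsAt_of_wplainLine_isoSingle`** — `hexI`'s ROW from the `klScaleWt_n`-weighted PLAIN four-leg pinned line `N₁` of `𝒱_n[K_n]` (leg `0`; the (T3w)/`hplainE1`
  object) and the weighted iso single character sums `≤ T m` at rates `Λ_m` (`n ≤ m ≤ n_β`), fit `(T m/(βL²))⁴·ε⁴·N₁ ≤ cM·|U| + cM′·(P.Klam·U)²` — every `n ≥ 1`, NO thin family;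
* §3 **`isoMomFlowAt_of_wplainLine_isoSingle (ha) (hTI) (hb) (hu₀) (hplainE1) (hisoW)`** ⊢ the `hexI` ∃-package (`IsoMomFlowAt`), from `hplainE1` (VERBATIM the family of
  `e4FlowAt_of_wplainLine_flow_deep`) and **`hisoW`** = the weighted iso single character sums of `klIsoFamily … (K_n) klE0 m` at rate `Λ_m` `≤ T_I·M·L²` (`n ≤ m ≤ n_β`) under the
  same osc-free binders — the WEIGHTED twin of the engine's landed `IsoTorusBoundAt klIsoT` (p4 g7), within the deep window at every `m ≥ n` (`A₃·Λ_m² ≤ Gfr₃U²·4^{n−2m}/3072`);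
  witness `E := (T_I/2)⁴·klE0·a + 1`, `d := 0`, `u := u₀ ⊓ 1/((T_I/2)⁴·klE0·bfun·Klam² + 1)`.
So row (b)'s geometry residual for `hexI` is ONE datum family (`hisoW`); `hthin0` and the thin pair data are no longer needed.  Everything is proved; no definitions;
`hplainE1`/`hisoW` have NO supplier in the tree; nothing asserts them, `hexI`, row (b), any stub of 20437, K3 or superconductivity.
References: BGM 2006 §2.7 (2.66), (2.70)–(2.71a), §2.8 (2.76)–(2.77), (2.82)–(2.84), §3 (3.2)–(3.8) [cite: BenfattoGiulianiMastropietro2006].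
-/

noncomputable section

namespace Summit.HubbardSuperconductivity.HubbardSuperconductivity.Theorems.EngineV8

set_option linter.dupNamespace false -- summit = problem name (single-conjunct summit), D-0017

open Classical
open Real Finset Literature.MathematicalPhysics.QuantumLattice Literature.Probability.LatticeModels GrassmannAlgebra
open Literature.Probability.LatticeModels.BattleFederbush
open Literature.MathematicalPhysics.QuantumLattice.FermiRG
open Summit.HubbardSuperconductivity.HubbardSuperconductivity.Theorems.KLProgrammeLegKernels
open Summit.HubbardSuperconductivity.HubbardSuperconductivity.Theorems.KLRegimeSplit
open Summit.HubbardSuperconductivity.HubbardSuperconductivity.Theorems.TorusFourierL2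
open Summit.HubbardSuperconductivity.HubbardSuperconductivity.Theorems.DispersionFlow

variable {L M : ℕ} [NeZero L] [NeZero M] {Λ : Type*} [DecidableEq Λ] {wt : Finset Λ → ℝ}

/-! ## §1 The iso twins of (T3w)'s plain → family weighted transfer -/

omit [DecidableEq Λ] in
/-- **WEIGHTED TRANSFER SUMS OF THE ISOTROPIC FAMILY (resolution `J`) AGAINST THE TRIVIAL FAMILY** from the weighted iso single character sums `≤ T` at rate `Λ_j`: the
pair-weighted column AND row sums of `E(klIsoFamily … J)·S(trivialMultiplier)` (labels matched) are `≤ T/(βL²)`. [cite: BenfattoGiulianiMastropietro2006, §2.7 (2.70)-(2.71a)] -/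
theorem transferSumsWt_klIso_single_le {β : ℝ} (hβ : 0 < β) (μ : ℝ) (K : TrigPolyC4v) (J j : ℕ) {T : ℝ}
    (hT : ∀ ω : Fin (sectorCount (2 * J)), ∑ z : TorusSite 1 (2 * M) × TorusSite 2 L,
      (1 + klScale klE0 j * β / (2 * M) * |(((z.1 0).valMinAbs : ℤ) : ℝ)| + klScale klE0 j * |(((z.2 0).valMinAbs : ℤ) : ℝ)| +
          klScale klE0 j * |(((z.2 1).valMinAbs : ℤ) : ℝ)|) *
      ‖∑ q : TorusSite 1 (2 * M) × TorusSite 2 L, (torusChar q.1 z.1 * torusChar q.2 z.2) •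
        klIsoFamily L M β μ K klE0 J ω (⟨(q.1 0).val, ZMod.val_lt (q.1 0)⟩, q.2)‖ ≤ T) :
    (∀ (ω' : Fin (sectorCount (2 * J))) (σ c : Fin 2) (y : SpaceTimeIdx L M),
      ∑ x : SpaceTimeIdx L M, ‖(sectorAnalysisMatrix L M β (klIsoFamily L M β μ K klE0 J) * sectorSubMatrix L M β (trivialMultiplier L M))
          (y, ((ω', σ), c)) (x, (((0 : Fin 1), σ), c))‖ *
        klScaleWt L M β j {latticeLegPos (2 * (2 * M)) ((y, ((ω', σ), c)) : SpaceTimeIdx L M × SectorLeg (sectorCount (2 * J))),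
          latticeLegPos (2 * (2 * M)) ((x, (((0 : Fin 1), σ), c)) : SpaceTimeIdx L M × SectorLeg 1)} ≤ T / (β * (L : ℝ) ^ 2)) ∧
    (∀ (ω' : Fin (sectorCount (2 * J))) (σ c : Fin 2) (x : SpaceTimeIdx L M),
      ∑ y : SpaceTimeIdx L M, ‖(sectorAnalysisMatrix L M β (klIsoFamily L M β μ K klE0 J) * sectorSubMatrix L M β (trivialMultiplier L M))
          (y, ((ω', σ), c)) (x, (((0 : Fin 1), σ), c))‖ *
        klScaleWt L M β j {latticeLegPos (2 * (2 * M)) ((y, ((ω', σ), c)) : SpaceTimeIdx L M × SectorLeg (sectorCount (2 * J))),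
          latticeLegPos (2 * (2 * M)) ((x, (((0 : Fin 1), σ), c)) : SpaceTimeIdx L M × SectorLeg 1)} ≤ T / (β * (L : ℝ) ^ 2)) := by
  have hT' : ∀ (ω' : Fin (sectorCount (2 * J))) (ω : Fin 1), ∑ z : TorusSite 1 (2 * M) × TorusSite 2 L,
      (1 + klScale klE0 j * β / (2 * M) * |(((z.1 0).valMinAbs : ℤ) : ℝ)| + klScale klE0 j * |(((z.2 0).valMinAbs : ℤ) : ℝ)| +
          klScale klE0 j * |(((z.2 1).valMinAbs : ℤ) : ℝ)|) *
      ‖∑ q : TorusSite 1 (2 * M) × TorusSite 2 L, (torusChar q.1 z.1 * torusChar q.2 z.2) •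
        (klIsoFamily L M β μ K klE0 J ω' (⟨(q.1 0).val, ZMod.val_lt (q.1 0)⟩, q.2) *
          trivialMultiplier L M ω (⟨(q.1 0).val, ZMod.val_lt (q.1 0)⟩, q.2))‖ ≤ T := by
    intro ω' ω
    simp only [trivialMultiplier, mul_one]
    exact hT ω'
  have h := overlapKernelWt_sums_le_of_charSumWt_le hβ (klIsoFamily L M β μ K klE0 J) (trivialMultiplier L M) j hT'
  exact ⟨fun ω' σ c y => h.1 ω' 0 σ c y, fun ω' σ c x => h.2 ω' 0 σ c x⟩

/-- **WEIGHTED ISO ALL-FIXED PINNED SUMS ≤ `c₁^m·c₁r·ε^{m+1}` × WEIGHTED PLAIN PINNED SUMS** (iso twin of `wprescribedSum_klAniso_le_of_plain_treeWt`: any tree weight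
`wt`, position map `g`, Grassmann element `G`, iso resolution `J`, leg count `m + 1`, iso label string `σ″`, pinned leg `p`).  The tree-weighted refinement lemma on the
plateau pair (trivial, trivial ; iso `J`), one parent. [cite: BenfattoGiulianiMastropietro2006, §2.8 (2.76)-(2.77), (2.82)-(2.84), §3 (3.2)-(3.8)] -/
theorem wprescribedSum_klIso_le_of_plain_treeWt (hwt : IsTreeWeight wt) (g : SpaceTimeIdx L M → Λ) {β : ℝ} (hβ : 0 < β) (μ : ℝ) (K : TrigPolyC4v)
    (J : ℕ) (G : HubbardGrassmann L M) {c₁ c₁r N₁ : ℝ} (hc₁0 : 0 ≤ c₁) (hc₁r0 : 0 ≤ c₁r) (hN₁0 : 0 ≤ N₁)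
    (hcol₁ : ∀ (ω'' : Fin (sectorCount (2 * J))) (σ c : Fin 2) (x' : SpaceTimeIdx L M),
      ∑ x'' : SpaceTimeIdx L M, ‖(sectorAnalysisMatrix L M β (klIsoFamily L M β μ K klE0 J) * sectorSubMatrix L M β (trivialMultiplier L M))
        (x'', ((ω'', σ), c)) (x', (((0 : Fin 1), σ), c))‖ * wt {g x'', g x'} ≤ c₁)
    (hrow₁ : ∀ (ω'' : Fin (sectorCount (2 * J))) (σ c : Fin 2) (x'' : SpaceTimeIdx L M),
      ∑ x' : SpaceTimeIdx L M, ‖(sectorAnalysisMatrix L M β (klIsoFamily L M β μ K klE0 J) * sectorSubMatrix L M β (trivialMultiplier L M))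
        (x'', ((ω'', σ), c)) (x', (((0 : Fin 1), σ), c))‖ * wt {g x'', g x'} ≤ c₁r)
    (m : ℕ) (σ'' : Fin (m + 1) → SectorLeg (sectorCount (2 * J))) (p : Fin (m + 1))
    (hN₁ : ∀ (τ' : Fin (m + 1) → SectorLeg 1) (y : SpaceTimeIdx L M),
      imagTimeWeight β M ^ m * ∑ x' ∈ univ.filter (fun x' : Fin (m + 1) → SpaceTimeIdx L M => x' p = y),
        wt ((univ.image x').image g) * ‖sectorisedKernel L M β (trivialMultiplier L M) G (m + 1) τ' x'‖ ≤ N₁)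
    (x : SpaceTimeIdx L M) :
    imagTimeWeight β M ^ m * ∑ x'' ∈ univ.filter (fun x'' : Fin (m + 1) → SpaceTimeIdx L M => x'' p = x),
        wt ((univ.image x'').image g) * ‖sectorisedKernel L M β (klIsoFamily L M β μ K klE0 J) G (m + 1) σ'' x''‖ ≤
      c₁ ^ m * c₁r * imagTimeWeight β M ^ (m + 1) * N₁ := by
  set F' := klIsoFamily L M β μ K klE0 J with hF'
  set F₁ := trivialMultiplier L M with hF₁
  -- the per-pair position sums for arbitrary label pairs: mismatched spin/charge entries vanish, the coarse label is `0`
  have hcol₁' : ∀ (ℓ'' : SectorLeg (sectorCount (2 * J))) (X' : SpaceTimeIdx L M × SectorLeg 1),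
      ∑ x'' : SpaceTimeIdx L M, ‖(sectorAnalysisMatrix L M β F' * sectorSubMatrix L M β F₁) (x'', ℓ'') X'‖ * wt {g x'', g X'.1} ≤ c₁ := by
    rintro ⟨⟨ω'', σ''⟩, c''⟩ ⟨x', ⟨ω', σ'⟩, c'⟩
    obtain rfl : ω' = 0 := Subsingleton.elim _ _
    by_cases hlab : σ' = σ'' ∧ c' = c''
    · obtain ⟨rfl, rfl⟩ := hlab
      exact hcol₁ ω'' σ' c' x'
    · refine le_of_eq_of_le (sum_eq_zero fun x'' _ => ?_) hc₁0
      rw [sectorAnalysis_mul_sectorSub_apply, if_neg (by exact hlab), norm_zero, zero_mul]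
  have hrow₁' : ∀ (X'' : SpaceTimeIdx L M × SectorLeg (sectorCount (2 * J))) (ℓ' : SectorLeg 1),
      ∑ x' : SpaceTimeIdx L M, ‖(sectorAnalysisMatrix L M β F' * sectorSubMatrix L M β F₁) X'' (x', ℓ')‖ * wt {g X''.1, g x'} ≤ c₁r := by
    rintro ⟨x'', ⟨ω'', σ''⟩, c''⟩ ⟨⟨ω', σ'⟩, c'⟩
    obtain rfl : ω' = 0 := Subsingleton.elim _ _
    by_cases hlab : σ' = σ'' ∧ c' = c''
    · obtain ⟨rfl, rfl⟩ := hlab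
      exact hrow₁ ω'' σ' c' x''
    · refine le_of_eq_of_le (sum_eq_zero fun x' _ => ?_) hc₁r0
      rw [sectorAnalysis_mul_sectorSub_apply, if_neg (by exact hlab), norm_zero, zero_mul]
  -- the spin/charge-matched coarse legs: exactly one
  have hρ : ∀ ℓ'' : SectorLeg (sectorCount (2 * J)),
      (((univ.filter fun ℓ' : SectorLeg 1 => True ∧ ℓ'.1.2 = ℓ''.1.2 ∧ ℓ'.2 = ℓ''.2).card : ℝ)) ≤ 1 := by
    intro ℓ''
    have hsub : (univ.filter fun ℓ' : SectorLeg 1 => True ∧ ℓ'.1.2 = ℓ''.1.2 ∧ ℓ'.2 = ℓ''.2) ⊆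
        {((((0 : Fin 1), ℓ''.1.2), ℓ''.2) : SectorLeg 1)} := by
      rintro ⟨⟨ω', σ'⟩, c'⟩ h
      rw [mem_filter] at h
      obtain rfl : ω' = 0 := Subsingleton.elim _ _
      rw [mem_singleton]
      obtain ⟨-, -, h2, h3⟩ := h
      simp only at h2 h3
      rw [h2, h3]
    have hcard := card_le_card hsub
    rw [card_singleton] at hcard
    exact_mod_cast hcard
  -- the weighted coarse prescribed sums (all legs prescribed: the single string `τ′`)
  have hfiltE : ∀ {Ns : ℕ} (τ' : Fin (m + 1) → SectorLeg Ns) (A : Finset (Fin (m + 1) → SectorLeg Ns)), τ' ∈ A →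
      A.filter (fun σ' : Fin (m + 1) → SectorLeg Ns => ∀ e ∈ (univ : Finset (Fin (m + 1))), σ' e = τ' e) = {τ'} := by
    intro Ns τ' A hA
    ext σ'
    simp only [mem_filter, mem_univ, true_implies, mem_singleton]
    constructor
    · rintro ⟨-, h⟩; exact funext h
    · rintro rfl; exact ⟨hA, fun _ => rfl⟩
  have hN₁' : ∀ (τ' : Fin (m + 1) → SectorLeg 1) (y : SpaceTimeIdx L M),
      imagTimeWeight β M ^ m *
        ∑ σ' ∈ univ.filter (fun σ' : Fin (m + 1) → SectorLeg 1 => ∀ e ∈ (univ : Finset (Fin (m + 1))), σ' e = τ' e),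
          ∑ x' ∈ univ.filter (fun x' : Fin (m + 1) → SpaceTimeIdx L M => x' p = y),
            wt ((univ.image x').image g) * ‖sectorisedKernel L M β F₁ G (m + 1) σ' x'‖ ≤ N₁ := by
    intro τ' y
    rw [hfiltE τ' univ (mem_univ _), sum_singleton]
    exact hN₁ τ' y
  have hN₂' : ∀ (τ' : Fin (m + 1) → SectorLeg 1) (y : SpaceTimeIdx L M),
      imagTimeWeight β M ^ m *
        ∑ σ' ∈ (∅ : Finset (Fin (m + 1) → SectorLeg 1)).filter
            (fun σ' : Fin (m + 1) → SectorLeg 1 => ∀ e ∈ (univ : Finset (Fin (m + 1))), σ' e = τ' e),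
          ∑ x' ∈ univ.filter (fun x' : Fin (m + 1) → SpaceTimeIdx L M => x' p = y),
            wt ((univ.image x').image g) * ‖sectorisedKernel L M β F₁ G (m + 1) σ' x'‖ ≤ 0 := by
    intro τ' y
    simp
  have h := hubbardSectorPrescribedSumWt_refine_le_split_of_plateau_pair_treeWt hwt g hβ F₁ F₁
    (fun ω q => by simp [hF₁, trivialMultiplier])
    (fun q hq ω => absurd hq (by simp [hF₁, trivialMultiplier])) F'
    (fun ω' q _ => by simp [hF₁, trivialMultiplier]) G
    (fun (_ : Fin (sectorCount (2 * J))) (_ : Fin 1) => True)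
    (fun ω'' ω' hno q => absurd trivial hno)
    hc₁0 hc₁r0 zero_le_one le_rfl hN₁0 le_rfl hcol₁' hrow₁' hρ
    m {σ''} ∅ univ σ'' p (mem_univ p)
    (fun σ' _ => by
      refine le_trans ?_ (le_of_eq Nat.cast_one)
      exact_mod_cast (card_filter_le _ _).trans (card_singleton σ'').le)
    (fun σ' hσ' => absurd hσ' (Finset.notMem_empty _)) hN₁' hN₂' x
  rw [hfiltE σ'' {σ''} (mem_singleton_self σ''), sum_singleton] at h
  refine h.trans (le_of_eq ?_)
  ring


/-! ## §2 `hexI`'s ROW from the weighted plain line and the weighted iso SINGLE character sums (every `n ≥ 1`, no thin family) -/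

omit [DecidableEq Λ] in
/-- **`IsoFirstMomentsAt` FROM THE WEIGHTED PLAIN FOUR-LEG LINE AND THE WEIGHTED ISO SINGLE CHARACTER SUMS**: if the `klScaleWt_n`-weighted plain four-leg pinned sums of
`𝒱_n[K_n]` at leg `0` are `≤ N₁`, at every resolution `n ≤ m ≤ n_β` the weighted single character sums of `klIsoFamily … (K_n) klE0 m` at rate `Λ_m` are `≤ T m`, and
`(T m/(βL²))⁴·ε⁴·N₁ ≤ cM·|U| + cM′·(P.Klam·U)²`, then `IsoFirstMomentsAt L M cM cM′ P β U μ n` (plateau pair (trivial, trivial ; iso m); rate `m ≥ n` is weaker,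
`klScaleWt_le_of_le`). [cite: BenfattoGiulianiMastropietro2006, §2.7 (2.70)-(2.71a), §2.8 (2.76)-(2.84), §3 (3.5)-(3.6)] -/
theorem isoFirstMomentsAt_of_wplainLine_isoSingle {β : ℝ} (hβ : 0 < β) (U μ : ℝ) (P : SplitConsts) (n : ℕ)
    {T : ℕ → ℝ} {N₁ : ℝ} (hT0 : ∀ m, 0 ≤ T m) (hN₁0 : 0 ≤ N₁) {cM cM' : ℝ}
    (hT : ∀ m, n ≤ m → m ≤ nScales β → ∀ σ : Fin (sectorCount (2 * m)), ∑ z : TorusSite 1 (2 * M) × TorusSite 2 L,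
      (1 + klScale klE0 m * β / (2 * M) * |(((z.1 0).valMinAbs : ℤ) : ℝ)| + klScale klE0 m * |(((z.2 0).valMinAbs : ℤ) : ℝ)| +
          klScale klE0 m * |(((z.2 1).valMinAbs : ℤ) : ℝ)|) *
      ‖∑ q : TorusSite 1 (2 * M) × TorusSite 2 L, (torusChar q.1 z.1 * torusChar q.2 z.2) •
        klIsoFamily L M β μ (klFlowFrameU L M β U μ n) klE0 m σ (⟨(q.1 0).val, ZMod.val_lt (q.1 0)⟩, q.2)‖ ≤ T m)
    (hplain : ∀ (τ' : Fin 4 → SectorLeg 1) (y : SpaceTimeIdx L M),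
      imagTimeWeight β M ^ 3 * ∑ x' ∈ univ.filter (fun x' : Fin 4 → SpaceTimeIdx L M => x' 0 = y),
        klScaleWt L M β n ((univ.image x').image (fun x : SpaceTimeIdx L M => (((((2 * (x.1 : ℕ) : ℕ)) : ZMod (2 * (2 * M)))), x.2))) *
          ‖sectorisedKernel L M β (trivialMultiplier L M)
            (klEffectiveAction L M β U μ (klFlowFrameU L M β U μ n) klE0 n) 4 τ' x'‖ ≤ N₁)
    (hfit : ∀ m, n ≤ m → m ≤ nScales β →
      (T m / (β * (L : ℝ) ^ 2)) ^ 3 * (T m / (β * (L : ℝ) ^ 2)) * imagTimeWeight β M ^ 3 * (imagTimeWeight β M * N₁) ≤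
        cM * |U| + cM' * (P.Klam * U) ^ 2) :
    IsoFirstMomentsAt L M cM cM' P β U μ n := by
  intro m hnm hm ω x₁ i
  have hL0 : (0 : ℝ) < L := Nat.cast_pos.2 (Nat.pos_of_ne_zero (NeZero.ne L))
  have hε : 0 ≤ imagTimeWeight β M := imagTimeWeight_nonneg hβ.le M
  set K : TrigPolyC4v := klFlowFrameU L M β U μ n with hK
  set 𝒱 : HubbardGrassmann L M := klEffectiveAction L M β U μ K klE0 n with h𝒱
  set gpos : SpaceTimeIdx L M → ZMod (2 * (2 * M)) × TorusSite 2 L :=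
    fun x => (((((2 * (x.1 : ℕ) : ℕ)) : ZMod (2 * (2 * M)))), x.2) with hgpos
  have hc0 : 0 ≤ T m / (β * (L : ℝ) ^ 2) := div_nonneg (hT0 m) (by positivity)
  obtain ⟨hrowS, hcolS⟩ := transferSumsWt_klIso_single_le hβ μ K m m (hT m hnm hm)
  have hwt : IsTreeWeight (klScaleWt L M β m) := isTreeWeight_klScaleWt L M hβ.le m
  -- the plain line at the weaker rate `m ≥ n`
  have hplainm : ∀ (τ' : Fin 4 → SectorLeg 1) (y : SpaceTimeIdx L M),
      imagTimeWeight β M ^ 3 * ∑ x' ∈ univ.filter (fun x' : Fin 4 → SpaceTimeIdx L M => x' 0 = y),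
        klScaleWt L M β m ((univ.image x').image gpos) * ‖sectorisedKernel L M β (trivialMultiplier L M) 𝒱 4 τ' x'‖ ≤ N₁ := by
    intro τ' y
    refine le_trans (mul_le_mul_of_nonneg_left (sum_le_sum fun x' _ => ?_) (pow_nonneg hε 3)) (hplain τ' y)
    exact mul_le_mul_of_nonneg_right (klScaleWt_le_of_le β hnm _) (norm_nonneg _)
  have hline := wprescribedSum_klIso_le_of_plain_treeWt hwt gpos hβ μ K m 𝒱 hc0 hc0 hN₁0
    (fun ω'' σ' c x' => hcolS ω'' σ' c x') (fun ω'' σ' c x'' => hrowS ω'' σ' c x'') 3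
    (fun k : Fin 4 => ((ω k, ![(0 : Fin 2), 0, 1, 1] k), ![(0 : Fin 2), 1, 0, 1] k)) 0 hplainm x₁
  refine ((klScale_mul_firstMoment_klIsoKernelAt_le_wtPinnedSum hβ.le U μ K n m m
    (fun k : Fin 4 => ((ω k, ![(0 : Fin 2), 0, 1, 1] k), ![(0 : Fin 2), 1, 0, 1] k)) x₁ i).trans (hline.trans (le_of_eq ?_))).trans (hfit m hnm hm)
  ring

/-! ## §3 THE `hexI` WITNESS from the E1 plain-line family and the weighted iso single data (osc-free, no thin family) -/

omit [NeZero L] [NeZero M] [DecidableEq Λ] in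
/-- **THE ISO-MOMENT WITNESS OF ROW (b) FROM `hplainE1` AND `hisoW` — BY TYPE**: `hplainE1` VERBATIM the E1 family of `e4FlowAt_of_wplainLine_flow_deep` (under `E4FlowAt`'s =
`IsoMomFlowAt`'s binders); `hisoW` = the weighted single character sums of the iso family `klIsoFamily … (K_n) klE0 m` at rate `Λ_m`, `≤ T_I·M·L²` for `n ≤ m ≤ n_β`, under the
same binders (`T_I` absolute).  Conclusion: `∃ Edu, 0 ≤ Edu.1 ∧ (∀ P R, 0 ≤ Edu.2.1 P R) ∧ (∀ G P R Q cc, 0 < Edu.2.2 G P R Q cc) ∧ IsoMomFlowAt Edu.1 Edu.2.1 Edu.2.2` — the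
type of `hexI` in `A24a1G14.stub_engine_step_norms_of_E1rows`. [cite: BenfattoGiulianiMastropietro2006, §2.7 (2.70)-(2.71a), §2.8 (2.76)-(2.84), §3 (3.2)-(3.8)] -/
theorem isoMomFlowAt_of_wplainLine_isoSingle {a T_I : ℝ} (ha : 0 ≤ a) (hTI : 0 ≤ T_I)
    {bfun u₀ : GeoConsts → SplitConsts → RenConsts → EngConsts → ℝ → ℝ}
    (hb : ∀ G P R Q cc, 0 ≤ bfun G P R Q cc) (hu₀ : ∀ G P R Q cc, 0 < u₀ G P R Q cc)
    (hplain : ∀ (G : GeoConsts), G.WF → ∀ (P : SplitConsts) (R : RenConsts) (Q : EngConsts) (cc : ℝ), P.WF → R.WF2 → Q.WF → 0 < cc →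
      cc ≤ klEngC₃6 P R → ∀ μ ∈ klWindowC, ∀ U : ℝ, 0 < U → U ≤ u₀ G P R Q cc →
      ∀ β : ℝ, klBetaMin ≤ β → β ≤ Real.exp (cc / U ^ 2) →
      ∀ (L M : ℕ) [NeZero L] [NeZero M], klEngL₃ β U ≤ L → klEngM₃ β U L ≤ M →
      ∀ n : ℕ, 1 ≤ n → n ≤ nScales β + 1 → IsKLRegime U cc (-(n : ℤ)) →
        HistP klPredsV17F2 L M G P Q R β U μ 0 n → FrameOK R U (nScales β) μ (klFlowFrameU L M β U μ n) →
        ∀ (τ' : Fin 4 → SectorLeg 1) (y : SpaceTimeIdx L M),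
          imagTimeWeight β M ^ 3 * ∑ x' ∈ univ.filter (fun x' : Fin 4 → SpaceTimeIdx L M => x' 0 = y),
            klScaleWt L M β n ((univ.image x').image (fun x : SpaceTimeIdx L M => (((((2 * (x.1 : ℕ) : ℕ)) : ZMod (2 * (2 * M)))), x.2))) *
              ‖sectorisedKernel L M β (trivialMultiplier L M)
                (klEffectiveAction L M β U μ (klFlowFrameU L M β U μ n) klE0 n) 4 τ' x'‖ ≤
          klE0 * (a * |U| + bfun G P R Q cc * (P.Klam * U) ^ 2))
    (hisoW : ∀ (G : GeoConsts), G.WF → ∀ (P : SplitConsts) (R : RenConsts) (Q : EngConsts) (cc : ℝ), P.WF → R.WF2 → Q.WF → 0 < cc →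
      cc ≤ klEngC₃6 P R → ∀ μ ∈ klWindowC, ∀ U : ℝ, 0 < U → U ≤ u₀ G P R Q cc →
      ∀ β : ℝ, klBetaMin ≤ β → β ≤ Real.exp (cc / U ^ 2) →
      ∀ (L M : ℕ) [NeZero L] [NeZero M], klEngL₃ β U ≤ L → klEngM₃ β U L ≤ M →
      ∀ n : ℕ, 1 ≤ n → n ≤ nScales β + 1 → IsKLRegime U cc (-(n : ℤ)) →
        HistP klPredsV17F2 L M G P Q R β U μ 0 n → FrameOK R U (nScales β) μ (klFlowFrameU L M β U μ n) →
        ∀ m, n ≤ m → m ≤ nScales β → ∀ σ : Fin (sectorCount (2 * m)),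
          ∑ z : TorusSite 1 (2 * M) × TorusSite 2 L,
            (1 + klScale klE0 m * β / (2 * M) * |(((z.1 0).valMinAbs : ℤ) : ℝ)| + klScale klE0 m * |(((z.2 0).valMinAbs : ℤ) : ℝ)| +
                klScale klE0 m * |(((z.2 1).valMinAbs : ℤ) : ℝ)|) *
            ‖∑ q : TorusSite 1 (2 * M) × TorusSite 2 L, (torusChar q.1 z.1 * torusChar q.2 z.2) •
              klIsoFamily L M β μ (klFlowFrameU L M β U μ n) klE0 m σ (⟨(q.1 0).val, ZMod.val_lt (q.1 0)⟩, q.2)‖ ≤ T_I * M * (L : ℝ) ^ 2) :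
    ∃ Edu : ℝ × (SplitConsts → RenConsts → ℝ) × (GeoConsts → SplitConsts → RenConsts → EngConsts → ℝ → ℝ),
      0 ≤ Edu.1 ∧ (∀ P R, 0 ≤ Edu.2.1 P R) ∧ (∀ G P R Q cc, 0 < Edu.2.2 G P R Q cc) ∧ IsoMomFlowAt Edu.1 Edu.2.1 Edu.2.2 := by
  have he : (0 : ℝ) < klE0 := by norm_num [klE0]
  set C : ℝ := (T_I / 2) ^ 4 * klE0 with hCdef
  have hC0 : 0 ≤ C := by positivity
  set u₁ : GeoConsts → SplitConsts → RenConsts → EngConsts → ℝ → ℝ :=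
    fun G P R Q cc => min (u₀ G P R Q cc) (1 / (C * bfun G P R Q cc * P.Klam ^ 2 + 1)) with hu₁
  have hu₁pos : ∀ G P R Q cc, 0 < u₁ G P R Q cc := fun G P R Q cc => by
    have := hb G P R Q cc
    exact lt_min (hu₀ G P R Q cc) (by positivity)
  refine ⟨(C * a + 1, fun _ _ => 0, u₁), by positivity, fun _ _ => le_rfl, hu₁pos, ?_⟩
  intro G hG P R Q cc hP hR hQ hcc hcc6 μ hμ U hU hUu β hβ hβc L M _ _ hL hM n hn1 hn hreg hhist hfr
  have hU0 : U ≤ u₀ G P R Q cc := hUu.trans (min_le_left _ _)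
  have hUth : U ≤ 1 / (C * bfun G P R Q cc * P.Klam ^ 2 + 1) := hUu.trans (min_le_right _ _)
  have hβ0 : 0 < β := KLRegimeSplit.pos_of_klBetaMin_le hβ
  have hM0 : (0 : ℝ) < M := Nat.cast_pos.2 (Nat.pos_of_ne_zero (NeZero.ne M))
  have hL0 : (0 : ℝ) < L := Nat.cast_pos.2 (Nat.pos_of_ne_zero (NeZero.ne L))
  have hN₁0 : 0 ≤ klE0 * (a * |U| + bfun G P R Q cc * (P.Klam * U) ^ 2) := by have := hb G P R Q cc; positivity
  refine isoFirstMomentsAt_of_wplainLine_isoSingle hβ0 U μ P n (T := fun _ => T_I * M * (L : ℝ) ^ 2) (fun _ => by positivity) hN₁0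
    (hisoW G hG P R Q cc hP hR hQ hcc hcc6 μ hμ U hU hU0 β hβ hβc L M hL hM n hn1 hn hreg hhist hfr)
    (hplain G hG P R Q cc hP hR hQ hcc hcc6 μ hμ U hU hU0 β hβ hβc L M hL hM n hn1 hn hreg hhist hfr) fun m _ _ => ?_
  have hq : T_I * M * (L : ℝ) ^ 2 / (β * (L : ℝ) ^ 2) * imagTimeWeight β M = T_I / 2 := by
    unfold imagTimeWeight
    field_simp
  have hlhs : (T_I * M * (L : ℝ) ^ 2 / (β * (L : ℝ) ^ 2)) ^ 3 * (T_I * M * (L : ℝ) ^ 2 / (β * (L : ℝ) ^ 2)) * imagTimeWeight β M ^ 3 *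
        (imagTimeWeight β M * (klE0 * (a * |U| + bfun G P R Q cc * (P.Klam * U) ^ 2))) =
      (T_I * M * (L : ℝ) ^ 2 / (β * (L : ℝ) ^ 2) * imagTimeWeight β M) ^ 4 * klE0 * (a * |U| + bfun G P R Q cc * (P.Klam * U) ^ 2) := by ring
  rw [hlhs, hq]
  have hquad : C * bfun G P R Q cc * (P.Klam * U) ^ 2 ≤ |U| := mul_sq_le_abs_of_le_threshold hC0 (hb G P R Q cc) hU hUth
  calc (T_I / 2) ^ 4 * klE0 * (a * |U| + bfun G P R Q cc * (P.Klam * U) ^ 2)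
      = C * a * |U| + C * bfun G P R Q cc * (P.Klam * U) ^ 2 := by rw [hCdef]; ring
    _ ≤ C * a * |U| + |U| := by linarith
    _ = (C * a + 1) * |U| + 0 * (P.Klam * U) ^ 2 := by ring

end Summit.HubbardSuperconductivity.HubbardSuperconductivity.Theorems.EngineV8

end
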